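import Summits.AnomalousDissipation.AnomalousDissipation.Theorems.TwoAndHalfDTwohalfdNegRegularCondensateKineticEnergyIneq
import Summits.AnomalousDissipation.AnomalousDissipation.Theorems.TwoAndHalfDTwohalfdNegRegularCondensateSelection
import Literature.Analysis.FluidPDE.PassiveScalarForcedClass
import Literature.Analysis.FluidPDE.PassiveScalarForcedTrace
import Literature.Analysis.FluidPDE.LongTimeAverageSlidingWindow
import HarnessLib

/-!
# Regular-condensate theorem, stub RC-LEV: the level package on a good block

Crux `TwoAndHalfD.TwohalfdNeg` (stmt-AnomalousDissipation-0211), line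
`log-kantorovich-enstrophy-transfer`, regular-condensate theorem (lead c7; block architecture:
good blocks → restart → Arzelà–Ascoli + weak `L²` limits → the limit solves the sourced TRANSPORT
equation → `κ = 0` conservative balance → ODE endgame). This file is the glue stub
`stub_rcLevel` (RC-LEV), one level of the block argument AFTER selection (`stub_rcSelection`: a
block `(a, a + S]` with variance mass `≤ Cv`, fluctuation mass `≤ Cf` against a bounded jointly
continuous comparison flow `W`, starting variance `≤ Cz`) and restart (`stub_rcRestart`:
`t ↦ θ (a + t)` is a global weak sourced scalar from the datum `θ a ∈ L²` over the drift
`t ↦ v (a + t)`, `v` a global planar Leray–Hopf flow).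

With `μ_S := (vol|_(0,S)) ⊗ vol` on `ℝ × T²` it delivers the seven inputs of the limit stubs:

1. the class of the restarted solution on the horizon `S + 1` (a global solution is one on every
   horizon);
2. joint measurability of `uncurry (t ↦ θ (a + t))` on `μ_S` (class lemma);
3. `θ(a + ·)² ∈ L¹(μ_S)` — the class is `L^∞(0, S; L²)` (Tonelli, `Level.integrable_sq`);
4. `∫_{μ_S} θ(a + ·)² = ∫_{(a, a+S]} ‖θ(t)‖² dt ≤ Cv` (Fubini, the translation `t ↦ a + t` and
   `Ioo` versus `Ioc`, `Level.setIntegral_Ioo_comp_add_left_eq_Ioc`);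
5. the uniform slice bound `‖θ(a + t)‖² ≤ Cz + (∫ h²) S + Cv` for a.e. `t ∈ (0, S)`: the landed
   kinetic energy inequality `stub_rcKineticEnergyIneq` (DiPerna–Lions renormalisation,
   `‖θ(t)‖² ≤ ‖θ₀‖² + 2∫₀ᵗ∫ θ h` over a drift with `∫₀ˢ ‖∇u‖_{L²} < ∞` — finite along a
   Leray–Hopf flow, `QuietOfSubLog.lintegral_window_rpow_half_lt_top`) for the restarted solution,
   plus `2 θ h ≤ h² + θ²` (`Level.two_mul_integral_mul_le_add`) and the variance mass;
6. the fluctuation mass in `lintegral` product form, `∫⁻_{μ_S} ‖v(a+·) - W(a+·)‖ₑ² ≤ ofReal Cf`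
   (Tonelli; every slice `v(t) - W(t)` is in `L²`, so `∫⁻ ‖·‖ₑ² = ofReal ∫ ‖·‖²`; the block
   functional `t ↦ ∫ ‖v(t) - W(t)‖²` is integrable, `Selection.integrableOn_fluct`);
7. the block power in product form, `∫_{μ_S} θ(a+·) h = ∫_{(a, a+S]} ∫ θ(t) h dt` (Fubini).

Sources: R. J. DiPerna, P.-L. Lions, Invent. Math. 98 (1989), §II.3, Thm. II.3 (energy
inequality) [`DiPernaLions1989`]; the rest is measure-theoretic bookkeeping [folklore]. Not here:
the selection of the block, the restart, the limits (neighbouring stubs).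
-/

noncomputable section

namespace Summit.AnomalousDissipation.AnomalousDissipation.Theorems.TwohalfdNeg.RegularCondensate

open MeasureTheory Filter Topology Set Function
open scoped ENNReal NNReal InnerProductSpace
open Literature.Analysis.FunctionSpaces Literature.Analysis.FluidPDE

-- the summit and the problem are both `AnomalousDissipation` (path convention), hence the dup:
set_option linter.dupNamespace false

namespace Level

variable {d : Type*} [Fintype d]

omit [Fintype d] in
/-- Time translation of a block integral: `∫_{(0,S)} G(a + t) dt = ∫_{(a, a+S]} G` for `S ≥ 0`
(translation invariance of Lebesgue measure; the endpoint is a null set). [folklore] -/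
theorem setIntegral_Ioo_comp_add_left_eq_Ioc {E : Type*} [NormedAddCommGroup E] [NormedSpace ℝ E]
    (G : ℝ → E) (a : ℝ) {S : ℝ} (hS : 0 ≤ S) :
    ∫ t in Ioo 0 S, G (a + t) = ∫ t in Ioc a (a + S), G t := by
  rw [← integral_Ioc_eq_integral_Ioo, ← intervalIntegral.integral_of_le hS,
    intervalIntegral.integral_comp_add_left G a, add_zero,
    intervalIntegral.integral_of_le (by linarith)]

/-- For a sourced weak passive scalar on `[0, T)` (class `L^∞(0,T; L²)`), `θ² ∈ L¹((0,T) × T^d)`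
(Tonelli and the `L^∞L²` bound). [folklore] -/
theorem integrable_sq {T κ : ℝ} {u : ℝ → UnitAddTorus d → EuclideanSpace ℝ d}
    {s : ℝ → UnitAddTorus d → ℝ} {θ₀ : UnitAddTorus d → ℝ} {θ : ℝ → UnitAddTorus d → ℝ}
    (H : Torus.IsWeakScalarTransportForcedOn T κ u s θ₀ θ) :
    Integrable (fun p : ℝ × UnitAddTorus d => θ p.1 p.2 ^ 2)
      (((volume : Measure ℝ).restrict (Ioo 0 T)).prod volume) := by
  obtain ⟨C, hC⟩ := H.ae_lintegral_sq_le
  have hm : AEStronglyMeasurable (fun p : ℝ × UnitAddTorus d => θ p.1 p.2 ^ 2)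
      (((volume : Measure ℝ).restrict (Ioo 0 T)).prod volume) :=
    (continuous_pow 2).comp_aestronglyMeasurable H.aestronglyMeasurable_uncurry
  refine ⟨hm, ?_⟩
  rw [hasFiniteIntegral_iff_enorm, lintegral_prod _ hm.enorm]
  calc ∫⁻ t in Ioo 0 T, ∫⁻ x, ‖θ t x ^ 2‖ₑ
      ≤ ∫⁻ _ in Ioo 0 T, (C : ℝ≥0∞) := by
        refine lintegral_mono_ae ?_
        filter_upwards [hC] with t ht
        simpa only [enorm_pow] using ht
    _ < ⊤ := by
        rw [setLIntegral_const]
        exact ENNReal.mul_lt_top ENNReal.coe_lt_top measure_Ioo_lt_top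

/-- The power against a continuous profile is controlled by squares:
`2 ∫ θ c ≤ ∫ c² + ∫ θ²` for `θ ∈ L²(T^d)` and continuous `c` (`2xy ≤ x² + y²` pointwise, no
Cauchy–Schwarz needed). [folklore] -/
theorem two_mul_integral_mul_le_add {θ c : UnitAddTorus d → ℝ} (hθ : MemLp θ 2 volume)
    (hc : Continuous c) :
    2 * ∫ x, θ x * c x ≤ (∫ x, c x ^ 2) + ∫ x, θ x ^ 2 := by
  have hc2 : Integrable (fun x => c x ^ 2) volume := (hc.pow 2).integrable_unitAddTorus
  have hθ2 : Integrable (fun x => θ x ^ 2) volume := hθ.integrable_sq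
  obtain ⟨C, hC⟩ := Torus.exists_forall_norm_le_of_continuous hc
  have hθc : Integrable (fun x => θ x * c x) volume :=
    (hθ.integrable one_le_two).mul_bdd hc.aestronglyMeasurable (ae_of_all _ hC)
  rw [← integral_const_mul, ← integral_add hc2 hθ2]
  refine integral_mono (hθc.const_mul 2) (hc2.add hθ2) fun x => ?_
  have h := two_mul_le_add_sq (c x) (θ x)
  dsimp only
  linarith

end Level

/-- **RC-LEV `stub_rcLevel` — the level package.** One level of the block argument after
selection and restart: from the restarted global weak sourced scalar `t ↦ θ (a + t)` (datum
`θ a ∈ L²`, drift `t ↦ v (a + t)`, `v` global Leray–Hopf) and the block bounds of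
`stub_rcSelection` (variance mass `≤ Cv`, fluctuation mass `≤ Cf` against a bounded continuous
comparison flow `W`, starting variance `≤ Cz`), the inputs of `stub_rcWeakLimit` / `stub_rcLimit`
on the block `(0, S)` (product measure `μ_S = (vol|(0,S)) ⊗ vol`): the class on the horizon
`S + 1`, joint measurability, integrability and the bound `≤ Cv` of `θ(a + ·)²` on `μ_S`
(Tonelli + translation `t ↦ a + t`, `Ioc` vs `Ioo` null), the uniform slice bound
`‖θ(a + t)‖² ≤ Cz + (∫h²) S + Cv` for a.e. `t ∈ (0, S)` (kinetic energy inequality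
`stub_rcKineticEnergyIneq` plus `2 θ h ≤ h² + θ²`), the fluctuation mass in `lintegral` product
form, and the block power in product form. [folklore] -/
theorem stub_rcLevel :
    ∀ (κ a S L Cv Cf Cz : ℝ) (g : UnitAddTorus (Fin 2) → EuclideanSpace ℝ (Fin 2))
      (v₀ : UnitAddTorus (Fin 2) → EuclideanSpace ℝ (Fin 2))
      (v W : ℝ → UnitAddTorus (Fin 2) → EuclideanSpace ℝ (Fin 2))
      (h θ₀ : UnitAddTorus (Fin 2) → ℝ) (θ : ℝ → UnitAddTorus (Fin 2) → ℝ),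
      0 < κ → 0 < a → 0 < S → Torus.IsSmooth g → Torus.HasZeroMean g →
      Torus.IsGlobalLerayHopf κ (fun _ => g) v₀ v →
      Continuous (Function.uncurry W) → (∀ t x, ‖W t x‖ ≤ L) →
      Torus.IsSmooth h → MemLp θ₀ 2 volume →
      Torus.IsWeakScalarTransportForced κ v (fun _ => h) θ₀ θ →
      MemLp (θ a) 2 volume →
      Torus.IsWeakScalarTransportForced κ (fun t => v (a + t)) (fun _ => h) (θ a) (fun t => θ (a + t)) →
      ∫ t in Set.Ioc a (a + S), Torus.scalarL2Sq (θ t) ≤ Cv →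
      ∫ t in Set.Ioc a (a + S), ∫ x, ‖v t x - W t x‖ ^ 2 ≤ Cf →
      Torus.scalarL2Sq (θ a) ≤ Cz →
      Torus.IsWeakScalarTransportForcedOn (S + 1) κ (fun t => v (a + t)) (fun _ => h) (θ a)
          (fun t => θ (a + t)) ∧
        AEStronglyMeasurable (Function.uncurry fun t => θ (a + t))
          (((volume : Measure ℝ).restrict (Set.Ioo 0 S)).prod volume) ∧
        Integrable (fun p : ℝ × UnitAddTorus (Fin 2) => θ (a + p.1) p.2 ^ 2)
          (((volume : Measure ℝ).restrict (Set.Ioo 0 S)).prod volume) ∧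
        ∫ p, θ (a + p.1) p.2 ^ 2 ∂(((volume : Measure ℝ).restrict (Set.Ioo 0 S)).prod volume) ≤ Cv ∧
        (∀ᵐ t ∂(volume.restrict (Set.Ioo 0 S)), ∫ x, θ (a + t) x ^ 2 ≤ Cz + (∫ x, h x ^ 2) * S + Cv) ∧
        ∫⁻ p, ‖v (a + p.1) p.2 - W (a + p.1) p.2‖ₑ ^ 2
            ∂(((volume : Measure ℝ).restrict (Set.Ioo 0 S)).prod volume) ≤ ENNReal.ofReal Cf ∧
        ∫ p, θ (a + p.1) p.2 * h p.2 ∂(((volume : Measure ℝ).restrict (Set.Ioo 0 S)).prod volume) =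
          ∫ t in Set.Ioc a (a + S), ∫ x, θ t x * h x := by
  intro κ a S L Cv Cf Cz g v₀ v W h θ₀ θ hκ ha hS hgs hgz hLH hW hWB hh _hθ₀ _hsol hθa hrest hCv hCf hCz
  -- the restarted class on the block horizon `S`
  have HS : Torus.IsWeakScalarTransportForcedOn S κ (fun t => v (a + t)) (fun _ => h) (θ a)
      (fun t => θ (a + t)) := hrest S hS
  -- (3) `θ(a + ·)² ∈ L¹(μ_S)`
  have h3 : Integrable (fun p : ℝ × UnitAddTorus (Fin 2) => θ (a + p.1) p.2 ^ 2)
      (((volume : Measure ℝ).restrict (Ioo 0 S)).prod volume) := Level.integrable_sq HS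
  -- (4) Fubini + translation: `∫_{μ_S} θ(a+·)² = ∫_{(a,a+S]} ‖θ(t)‖²`
  have h4eq : ∫ p, θ (a + p.1) p.2 ^ 2 ∂(((volume : Measure ℝ).restrict (Ioo 0 S)).prod volume) =
      ∫ t in Ioc a (a + S), Torus.scalarL2Sq (θ t) := by
    rw [integral_prod _ h3]
    exact Level.setIntegral_Ioo_comp_add_left_eq_Ioc (fun t => Torus.scalarL2Sq (θ t)) a hS.le
  have h4 : ∫ p, θ (a + p.1) p.2 ^ 2 ∂(((volume : Measure ℝ).restrict (Ioo 0 S)).prod volume) ≤ Cv :=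
    h4eq.trans_le hCv
  -- (5) the uniform slice bound
  have h5 : ∀ᵐ t ∂(volume.restrict (Ioo 0 S)), ∫ x, θ (a + t) x ^ 2 ≤ Cz + (∫ x, h x ^ 2) * S + Cv := by
    have hG : ∫⁻ t in Ioo 0 S, Torus.eGradNormSq (v (a + t)) ^ (1 / 2 : ℝ) < ⊤ :=
      QuietOfSubLog.lintegral_window_rpow_half_lt_top hLH ha.le hS
    have hkin := stub_rcKineticEnergyIneq κ S (fun t => v (a + t)) h (θ a) (fun t => θ (a + t))
      hκ hS hh hθa HS hG
    -- the power and its majorant `B = ∫ h² + ∫ θ(a+·)²` on `(0, S)`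
    have hPi : IntegrableOn (fun τ => ∫ x, θ (a + τ) x * h x) (Ioo 0 S) :=
      (HS.integrable_mul_continuous hh.continuous).integral_prod_left
    have hθ2i : IntegrableOn (fun τ => ∫ x, θ (a + τ) x ^ 2) (Ioo 0 S) := h3.integral_prod_left
    have hci : IntegrableOn (fun _ : ℝ => ∫ x, h x ^ 2) (Ioo 0 S) :=
      integrableOn_const (hs := measure_Ioo_lt_top.ne)
    have hBi : IntegrableOn (fun τ => (∫ x, h x ^ 2) + ∫ x, θ (a + τ) x ^ 2) (Ioo 0 S) := hci.add hθ2i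
    have hPB : ∀ᵐ τ ∂(volume.restrict (Ioo 0 S)),
        2 * (∫ x, θ (a + τ) x * h x) ≤ (∫ x, h x ^ 2) + ∫ x, θ (a + τ) x ^ 2 := by
      filter_upwards [HS.ae_memLp_two] with τ hτ
      exact Level.two_mul_integral_mul_le_add hτ hh.continuous
    have hB0 : ∀ τ, 0 ≤ (∫ x, h x ^ 2) + ∫ x, θ (a + τ) x ^ 2 := fun τ =>
      add_nonneg (integral_nonneg fun x => sq_nonneg _) (integral_nonneg fun x => sq_nonneg _)
    have hθ2le : ∫ τ in Ioo 0 S, ∫ x, θ (a + τ) x ^ 2 ≤ Cv := (integral_prod _ h3).symm.le.trans h4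
    have hBint : ∫ τ in Ioo 0 S, ((∫ x, h x ^ 2) + ∫ x, θ (a + τ) x ^ 2) ≤ (∫ x, h x ^ 2) * S + Cv := by
      rw [integral_add hci hθ2i, setIntegral_const, Real.volume_real_Ioo_of_le hS.le, sub_zero,
        smul_eq_mul]
      linarith
    filter_upwards [hkin, ae_restrict_mem measurableSet_Ioo] with t ht htS
    have hsub : Ioc 0 t ⊆ Ioo 0 S := fun τ hτ => ⟨hτ.1, hτ.2.trans_lt htS.2⟩
    have h2P : 2 * ∫ τ in Ioc 0 t, ∫ x, θ (a + τ) x * h x ≤ (∫ x, h x ^ 2) * S + Cv := by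
      calc 2 * ∫ τ in Ioc 0 t, ∫ x, θ (a + τ) x * h x
          = ∫ τ in Ioc 0 t, 2 * ∫ x, θ (a + τ) x * h x := (integral_const_mul _ _).symm
        _ ≤ ∫ τ in Ioc 0 t, ((∫ x, h x ^ 2) + ∫ x, θ (a + τ) x ^ 2) :=
            integral_mono_ae ((hPi.mono_set hsub).const_mul 2) (hBi.mono_set hsub)
              (ae_restrict_of_ae_restrict_of_subset hsub hPB)
        _ ≤ ∫ τ in Ioo 0 S, ((∫ x, h x ^ 2) + ∫ x, θ (a + τ) x ^ 2) :=
            setIntegral_mono_set hBi (ae_of_all _ hB0) hsub.eventuallyLE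
        _ ≤ (∫ x, h x ^ 2) * S + Cv := hBint
    have hz : ∫ x, θ a x ^ 2 ≤ Cz := hCz
    linarith
  -- (6) the fluctuation mass in `lintegral` product form
  have h6 : ∫⁻ p, ‖v (a + p.1) p.2 - W (a + p.1) p.2‖ₑ ^ 2
      ∂(((volume : Measure ℝ).restrict (Ioo 0 S)).prod volume) ≤ ENNReal.ofReal Cf := by
    set F : ℝ → ℝ := fun t => ∫ x, ‖v t x - W t x‖ ^ 2 with hF
    have hWc : Continuous (fun p : ℝ × UnitAddTorus (Fin 2) => W (a + p.1) p.2) :=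
      hW.comp ((continuous_const.add continuous_fst).prodMk continuous_snd)
    have hm : AEMeasurable (fun p : ℝ × UnitAddTorus (Fin 2) => ‖v (a + p.1) p.2 - W (a + p.1) p.2‖ₑ ^ 2)
        (((volume : Measure ℝ).restrict (Ioo 0 S)).prod volume) :=
      (HS.aestronglyMeasurable_uncurry_velocity.sub hWc.aestronglyMeasurable).enorm.pow_const 2
    have hslice : ∀ t ∈ Ioo 0 S,
        ∫⁻ x, ‖v (a + t) x - W (a + t) x‖ₑ ^ 2 = ENNReal.ofReal (F (a + t)) := by
      intro t ht
      have hv2 : MemLp (v (a + t)) 2 volume := hLH.memLp_two (by linarith [ht.1])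
      have hW2 : MemLp (W (a + t)) 2 volume :=
        MemLp.of_bound (hW.uncurry_left (a + t)).aestronglyMeasurable L (ae_of_all _ (hWB (a + t)))
      exact lintegral_enorm_sq_eq_ofReal (hv2.sub hW2)
    have hFi : IntegrableOn (fun t => F (a + t)) (Ioo 0 S) :=
      Torus.integrableOn_Ioo_comp_add_left
        ((Selection.integrableOn_fluct hκ hgs hgz hLH hW hWB (a + S)).mono_set
          fun t ht => ⟨ha.trans ht.1, ht.2.le⟩)
    have hF0 : ∀ t, 0 ≤ F t := fun t => integral_nonneg fun x => sq_nonneg _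
    calc ∫⁻ p, ‖v (a + p.1) p.2 - W (a + p.1) p.2‖ₑ ^ 2
          ∂(((volume : Measure ℝ).restrict (Ioo 0 S)).prod volume)
        = ∫⁻ t in Ioo 0 S, ∫⁻ x, ‖v (a + t) x - W (a + t) x‖ₑ ^ 2 := lintegral_prod _ hm
      _ = ∫⁻ t in Ioo 0 S, ENNReal.ofReal (F (a + t)) := setLIntegral_congr_fun measurableSet_Ioo hslice
      _ = ENNReal.ofReal (∫ t in Ioo 0 S, F (a + t)) :=
          (ofReal_integral_eq_lintegral_ofReal hFi (ae_of_all _ fun t => hF0 (a + t))).symm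
      _ = ENNReal.ofReal (∫ t in Ioc a (a + S), F t) := by
          rw [Level.setIntegral_Ioo_comp_add_left_eq_Ioc F a hS.le]
      _ ≤ ENNReal.ofReal Cf := ENNReal.ofReal_le_ofReal hCf
  -- (7) the block power in product form
  have h7 : ∫ p, θ (a + p.1) p.2 * h p.2 ∂(((volume : Measure ℝ).restrict (Ioo 0 S)).prod volume) =
      ∫ t in Ioc a (a + S), ∫ x, θ t x * h x := by
    rw [integral_prod _ (HS.integrable_mul_continuous hh.continuous)]
    exact Level.setIntegral_Ioo_comp_add_left_eq_Ioc (fun t => ∫ x, θ t x * h x) a hS.le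
  exact ⟨hrest (S + 1) (by linarith), HS.aestronglyMeasurable_uncurry, h3, h4, h5, h6, h7⟩

end Summit.AnomalousDissipation.AnomalousDissipation.Theorems.TwohalfdNeg.RegularCondensate

end
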